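import Mathlib.Data.Nat.Log
import Mathlib.Tactic.Ring
import Mathlib.Tactic.Linarith
import Mathlib.Tactic.IntervalCases
import HarnessLib

/-!
# Sao–Miniskar–Valero-Lara–Teranishi–Seal 2026: tree-shape statistics of reduction trees

HONEST FRAMING: certified error envelopes and provably optimal rounding/accumulation schemes for
low-precision formats under stated cost models; every table by two implementations; no hardware
or vendor claims.

Source. P. Sao, N. Miniskar, P. Valero-Lara, K. Teranishi, S. Seal, *A Second-Moment Theory for
Floating-Point Reduction Trees*, arXiv:2607.18758 (July 2026) [cite: SaoEtAl2026].

What is typed here (verbatim, the COMBINATORIAL layer of the paper — statements about the shape of a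
full binary reduction tree `T` with `k` leaves, `L(v)` = the leaves below the internal node `v`):
* Cor. 2.5, (11): the statistics `Λ₁(T) = Σ_{v ∈ I(T)} |L(v)|` and `Λ₂(T) = Σ_{v ∈ I(T)} |L(v)|²`
  (for i.i.d. inputs of mean `μ`, variance `τ²` the tree-dependent cost is `τ²Λ₁ + μ²Λ₂`), with the
  closed forms of the table after Cor. 2.5: sequential `Λ₁ = k(k+1)/2 − 1`,
  `Λ₂ = k(k+1)(2k+1)/6 − 1`; pairwise on `k = 2^j` leaves `Λ₁ = k log₂ k`, `Λ₂ = 2k² − 2k` — PROVED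
  below by induction;
* Prop. 3.1 (Λ₁-extrema): "Among full binary trees with `k` leaves,
  `Λ₁^min(k) = k⌊log₂ k⌋ + 2(k − 2^⌊log₂ k⌋)`, `Λ₁^max(k) = k(k+1)/2 − 1`. Nearly complete balanced
  trees attain the minimum; the sequential tree attains the maximum." — typed as the NAMED FACTS
  `Lambda1Extrema` (the two bounds for every tree) and `Lambda1ExtremaAttained` (D-0014: `def … :
  Prop`, used as hypotheses). Both are DISCHARGED (proved) on the venture side,
  `Summit.Ventures.CertifiedArithmetic.LowPrec.SR` (file `SRSaoBridge.lean`: `lambda1Extrema_holds`,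
  `lambda1ExtremaAttained_holds`), where also the `Λ₂` analogue — NOT in the source, which optimises
  `Λ₂` only inside blocked / fixed-stage families (Props. 3.3, 3.4) — is proved: the halving tree
  minimises and the sequential tree maximises `Λ₂` over all binary trees
  (`SRTreeDesign.optSq_le_sizeSq`, `SRTreeExtremal.six_mul_sizeSq_le`).

NOT typed here: Thm. 2.2 (exact second-moment recurrence `V_v = V_{v₁} + V_{v₂} + E ψ_v(x_v)` under
conditionally unbiased rounding), Cor. 2.3 (constant-`ν` closure, a MODEL), Prop. 2.4 (kernel
form `Σ_v q_v² = pᵀ K_T p`), Prop. 3.2 (variance-weighted Huffman), §4 (GEMM) — these are statements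
about a probabilistic rounding model; the exact finite-format counterpart of Thm. 2.2 / Cor. 2.3 for
stochastic rounding (with saturation and subnormal hypotheses explicit) is proved measure-free in
the venture files `LowPrec/SRTreeEnvelopes.lean` (`treeExp_sq_sub`) and
`LowPrec/SRSecondMoment.lean` (`valueSet_treeVar_le_secondMoment`).
-/

namespace Literature.ComputerArithmetic.SaoEtAl2026

/-- The SHAPE of a full binary reduction tree: a leaf (one input) or an internal node combining two
subtrees [cite: SaoEtAl2026, §2.1]. -/
inductive Shape : Type
  | leaf : Shape
  | node : Shape → Shape → Shape

namespace Shape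

/-- `|L(v)|` at the root: the number of leaves `k` of the tree [cite: SaoEtAl2026, §2.1]. -/
def size : Shape → ℕ
  | leaf => 1
  | node l r => l.size + r.size

/-- `Λ₁(T) = Σ_{v ∈ I(T)} |L(v)|`, the sum over internal nodes of the number of leaves below — the
external path length (total leaf depth) [cite: SaoEtAl2026, Cor. 2.5, (11)]. -/
def lambda1 : Shape → ℕ
  | leaf => 0
  | node l r => (l.size + r.size) + l.lambda1 + r.lambda1

/-- `Λ₂(T) = Σ_{v ∈ I(T)} |L(v)|²` [cite: SaoEtAl2026, Cor. 2.5, (11)]. -/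
def lambda2 : Shape → ℕ
  | leaf => 0
  | node l r => (l.size + r.size) ^ 2 + l.lambda2 + r.lambda2

/-- The sequential (recursive-summation) tree on `n+1` leaves: a left comb
[cite: SaoEtAl2026, §2.4 table ("Sequential")]. -/
def sequential : ℕ → Shape
  | 0 => leaf
  | n + 1 => node (sequential n) leaf

/-- The perfect pairwise tree of depth `j` (`2^j` leaves) [cite: SaoEtAl2026, §2.4 table ("Pairwise,
k = 2^j")]. -/
def perfect : ℕ → Shape
  | 0 => leaf
  | j + 1 => node (perfect j) (perfect j)

/-- The halving ("nearly complete balanced", pairwise-summation) tree on `n ≥ 1` leaves: split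
`n = ⌊n/2⌋ + ⌈n/2⌉` recursively [cite: SaoEtAl2026, Prop. 3.1]. (`halving 0` is a junk leaf.) -/
def halving : ℕ → Shape
  | 0 => leaf
  | 1 => leaf
  | n + 2 => node (halving ((n + 2) / 2)) (halving ((n + 3) / 2))
decreasing_by all_goals omega

/-- Every full binary tree has `k ≥ 1` leaves. [cite: SaoEtAl2026, §2.1] -/
theorem size_pos : ∀ T : Shape, 1 ≤ T.size
  | leaf => le_rfl
  | node l _ => Nat.le_trans (size_pos l) (Nat.le_add_right _ _)

/-! ### The closed forms of the table after Cor. 2.5 (proved) -/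

/-- The sequential tree `sequential n` has `k = n+1` leaves. [cite: SaoEtAl2026, §2.4 table] -/
theorem size_sequential : ∀ n : ℕ, (sequential n).size = n + 1
  | 0 => rfl
  | n + 1 => by simp [sequential, size, size_sequential n]

/-- Sequential, `k = n+1` leaves: `Λ₁ = k(k+1)/2 − 1`, i.e. `2Λ₁ + 2 = k(k+1)`
[cite: SaoEtAl2026, §2.4 table]. -/
theorem lambda1_sequential : ∀ n : ℕ, 2 * (sequential n).lambda1 + 2 = (n + 1) * (n + 2)
  | 0 => rfl
  | n + 1 => by
      have ih := lambda1_sequential n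
      simp only [sequential, lambda1, size_sequential, size]
      nlinarith [ih]

/-- Sequential, `k = n+1` leaves: `Λ₂ = k(k+1)(2k+1)/6 − 1`, i.e. `6Λ₂ + 6 = k(k+1)(2k+1)`
[cite: SaoEtAl2026, §2.4 table]. -/
theorem lambda2_sequential : ∀ n : ℕ,
    6 * (sequential n).lambda2 + 6 = (n + 1) * (n + 2) * (2 * n + 3)
  | 0 => rfl
  | n + 1 => by
      have ih := lambda2_sequential n
      simp only [sequential, lambda2, size_sequential, size]
      nlinarith [ih]

/-- The perfect pairwise tree of depth `j` has `k = 2^j` leaves. [cite: SaoEtAl2026, §2.4 table] -/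
theorem size_perfect : ∀ j : ℕ, (perfect j).size = 2 ^ j
  | 0 => rfl
  | j + 1 => by simp [perfect, size, size_perfect j]; ring

/-- Pairwise, `k = 2^j`: `Λ₁ = k log₂ k = j·2^j` [cite: SaoEtAl2026, §2.4 table]. -/
theorem lambda1_perfect : ∀ j : ℕ, (perfect j).lambda1 = j * 2 ^ j
  | 0 => rfl
  | j + 1 => by simp [perfect, lambda1, size_perfect, lambda1_perfect j]; ring

/-- Pairwise, `k = 2^j`: `Λ₂ = 2k² − 2k`, i.e. `Λ₂ + 2k = 2k²` [cite: SaoEtAl2026, §2.4 table]. -/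
theorem lambda2_perfect : ∀ j : ℕ, (perfect j).lambda2 + 2 * 2 ^ j = 2 * (2 ^ j) ^ 2
  | 0 => rfl
  | j + 1 => by
      have ih := lambda2_perfect j
      simp only [perfect, lambda2, size_perfect]
      have e : (2 : ℕ) ^ (j + 1) = 2 * 2 ^ j := by ring
      rw [e]; nlinarith [ih]

/-- The example of Fig. 1 (`k = 8`): sequential `Λ₁ = 35`, `Λ₂ = 203`; pairwise `Λ₁ = 24`,
`Λ₂ = 112` [cite: SaoEtAl2026, Fig. 1]. -/
theorem fig1_values : (sequential 7).lambda1 = 35 ∧ (sequential 7).lambda2 = 203 ∧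
    (perfect 3).lambda1 = 24 ∧ (perfect 3).lambda2 = 112 := by
  refine ⟨?_, ?_, ?_, ?_⟩ <;> rfl

/-! ### Prop. 3.1 (Λ₁-extrema) as named facts -/

/-- **Prop. 3.1 (Λ₁-extrema), the bounds.** "Among full binary trees with `k` leaves,
`Λ₁^min(k) = k⌊log₂ k⌋ + 2(k − 2^⌊log₂ k⌋)` and `Λ₁^max(k) = k(k+1)/2 − 1`": every tree's `Λ₁` lies
between the two (the upper bound stated as `2Λ₁ + 2 ≤ k(k+1)`). NAMED FACT, discharged on the
venture side (`LowPrec.SR.lambda1Extrema_holds`). [cite: SaoEtAl2026, Prop. 3.1] -/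
def Lambda1Extrema : Prop :=
  ∀ T : Shape, T.size * Nat.log 2 T.size + 2 * (T.size - 2 ^ Nat.log 2 T.size) ≤ T.lambda1 ∧
    2 * T.lambda1 + 2 ≤ T.size * (T.size + 1)

/-- **Prop. 3.1 (Λ₁-extrema), attainment.** "Nearly complete balanced trees attain the minimum; the
sequential tree attains the maximum": for every `k ≥ 1` the halving tree on `k` leaves has
`Λ₁ = k⌊log₂ k⌋ + 2(k − 2^⌊log₂ k⌋)` and the sequential tree has `2Λ₁ + 2 = k(k+1)`. NAMED FACT,
discharged on the venture side (`LowPrec.SR.lambda1ExtremaAttained_holds`).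
[cite: SaoEtAl2026, Prop. 3.1] -/
def Lambda1ExtremaAttained : Prop :=
  ∀ k : ℕ, 1 ≤ k → (halving k).size = k ∧
    (halving k).lambda1 = k * Nat.log 2 k + 2 * (k - 2 ^ Nat.log 2 k) ∧
    2 * (sequential (k - 1)).lambda1 + 2 = k * (k + 1)

/-- The attainment half of Prop. 3.1 for the sequential tree is the closed form above.
[cite: SaoEtAl2026, Prop. 3.1] -/
theorem lambda1ExtremaAttained_sequential {k : ℕ} (hk : 1 ≤ k) :
    2 * (sequential (k - 1)).lambda1 + 2 = k * (k + 1) := by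
  have h := lambda1_sequential (k - 1)
  have e1 : k - 1 + 1 = k := by omega
  have e2 : k - 1 + 2 = k + 1 := by omega
  rwa [e1, e2] at h

end Shape

end Literature.ComputerArithmetic.SaoEtAl2026
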